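import Literature.NumberTheory.Automorphic.SmoothDualLevel
import Literature.NumberTheory.Automorphic.SmoothRepresentationProofs
import HarnessLib

/-!
# Supercuspidality under quotients, contragredients and restriction to open subgroups

Generic facts about `Representation.IsSupercuspidal` (smooth matrix coefficients compactly
supported modulo the centre; Harish-Chandra 1970, Bernstein–Zelevinsky 1976, §3.21) needed to feed
the abstract level bound `exists_fixedPoints_ne_bot_of_compact_constituent` (`SmoothDualLevel`):

* `IsSupercuspidal.of_surjective` — a quotient (surjective intertwining image) of a supercuspidal
  representation is supercuspidal (its coefficients are coefficients of the source);
* `IsSupercuspidal.contragredientRep` — the contragredient of an *admissible* supercuspidal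
  representation is supercuspidal: by **reflexivity** (`exists_eval_eq_of_mem_contragredient_contragredient`:
  every smooth linear form on `Ṽ` is evaluation at a vector of `V`, for `V` admissible) its
  coefficients are `g ↦ c_{λ,v}(g⁻¹)`;
* `IsSupercuspidal.compSubtype` — restriction to an open subgroup `H` preserves supercuspidality
  (`C·Z(L) ∩ H ⊆ C'·Z(H)`: finitely many cosets of `H` meet a compact set).

Theorems only; no definitions, no named facts.

## References

* I. N. Bernstein, A. V. Zelevinsky, *Representations of the group `GL(n, F)` where `F` is a
  non-archimedean local field*, Russian Math. Surveys 31:3 (1976), §2.13–2.15, §3.21.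
* C. J. Bushnell, G. Henniart, *The local Langlands conjecture for `GL(2)`* (2006), §2.8–2.10, §10.1.
-/

noncomputable section

open scoped Pointwise

namespace Representation

open Literature.NumberTheory.Automorphic Literature.NumberTheory.Automorphic.SmoothProjector

/-! ### Quotients -/

section Quotient

variable {k G V W : Type*} [CommRing k] [Group G] [TopologicalSpace G] [SeparatelyContinuousMul G]
  [AddCommGroup V] [Module k V] [AddCommGroup W] [Module k W]
  {ρ : Representation k G V} {σ : Representation k G W}

/-- **Quotients of supercuspidal representations are supercuspidal**: for a surjective
intertwining map `q : ρ → σ`, the coefficient `c_{φ, q w}` of `σ` is the coefficient `c_{φ ∘ q, w}`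
of `ρ`, and `φ ∘ q` is smooth when `φ` is. [folklore] -/
theorem IsSupercuspidal.of_surjective (hρ : ρ.IsSupercuspidal) (q : ρ.IntertwiningMap σ)
    (hq : Function.Surjective q) : σ.IsSupercuspidal := by
  intro φ hφ w
  obtain ⟨v, rfl⟩ := hq w
  obtain ⟨C, hC, hsupp⟩ := hρ (q.dualMap φ) (IsSmoothVector.map q.dualMap hφ) v
  refine ⟨C, hC, fun g hg => hsupp ?_⟩
  rw [Function.mem_support, matrixCoeff_apply] at hg ⊢
  rwa [IntertwiningMap.dualMap_apply, q.isIntertwining]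

end Quotient

/-! ### Adjointness of averaging -/

section Adjoint

variable {k G V : Type*} [Field k] [CharZero k] [Group G] [TopologicalSpace G] [IsTopologicalGroup G]
  [AddCommGroup V] [Module k V] {ρ : Representation k G V}

/-- **Averaging is self-adjoint**: `(e_K λ) x = λ (e_K x)` for a smooth form `λ` and a smooth
vector `x` (`K` compact): compute both averages on a common *normal* finite-index subgroup `B ≤ K`
and reindex the finite sum over the group `K / B` by inversion. [folklore] -/
theorem avg_dual_apply_eq_apply_avg {K : Subgroup G} (hK : IsCompact (K : Set G)) {lam : Module.Dual k V}
    (hlam : ρ.dual.IsSmoothVector lam) {x : V} (hx : ρ.IsSmoothVector x) :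
    (avg ρ.dual K lam) x = lam (avg ρ K x) := by
  classical
  haveI := finiteIndex_stabIn hK hlam
  haveI := finiteIndex_stabIn hK hx
  set B₀ : Subgroup K := stabIn ρ.dual K lam ⊓ stabIn ρ K x with hB₀
  haveI : B₀.FiniteIndex := by rw [hB₀]; infer_instance
  set B : Subgroup K := B₀.normalCore with hB
  haveI hBn : B.Normal := Subgroup.normalCore_normal B₀
  haveI : B.FiniteIndex := by
    rw [hB]
    exact Subgroup.finiteIndex_normalCore B₀
  haveI : Fintype (K ⧸ B) := Fintype.ofFinite _
  have hBlam : B ≤ stabIn ρ.dual K lam := (Subgroup.normalCore_le B₀).trans inf_le_left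
  have hBx : B ≤ stabIn ρ K x := (Subgroup.normalCore_le B₀).trans inf_le_right
  rw [avg_eq_index_inv_smul_finsum B hBlam, avg_eq_index_inv_smul_finsum B hBx, LinearMap.smul_apply, map_smul,
    finsum_eq_sum_of_fintype, finsum_eq_sum_of_fintype, LinearMap.sum_apply, map_sum]
  congr 1
  -- reindex by inversion in the group `K / B`
  refine Fintype.sum_equiv (Equiv.inv (K ⧸ B)) _ _ fun q => ?_
  simp only [dual_apply, Module.Dual.transpose_apply, LinearMap.comp_apply, Equiv.inv_apply]
  congr 1
  -- `ρ (q̃)⁻¹ x = ρ ((q⁻¹)~) x` since `q̃ (q⁻¹)~ ∈ B` and `B` fixes `x`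
  set a : K := q.out with ha
  set b : K := (q⁻¹ : K ⧸ B).out with hb
  have hab : QuotientGroup.mk (s := B) a⁻¹ = QuotientGroup.mk b := by
    rw [QuotientGroup.mk_inv, ha, hb, QuotientGroup.out_eq', QuotientGroup.out_eq']
  have hmem : a * b ∈ B := by
    have := QuotientGroup.eq.1 hab
    rwa [inv_inv] at this
  have hfix : ρ ((a * b : K) : G) x = x := Subgroup.mem_subgroupOf.1 (hBx hmem)
  calc ρ ((a : K) : G)⁻¹ x = ρ ((a : K) : G)⁻¹ (ρ ((a * b : K) : G) x) := by rw [hfix]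
    _ = ρ ((b : K) : G) x := by
        rw [← Module.End.mul_apply, ← map_mul, Subgroup.coe_mul, ← mul_assoc, inv_mul_cancel, one_mul]

end Adjoint

/-! ### Reflexivity of admissible representations and the contragredient -/

section Reflexive

variable {k G V : Type*} [Field k] [CharZero k] [Group G] [TopologicalSpace G] [IsTopologicalGroup G]
  [AddCommGroup V] [Module k V] {ρ : Representation k G V}

/-- The form underlying the `K`-average of `λ ∈ Ṽ` is the `K`-average in `V^*`. [folklore] -/
theorem subtype_avg_contragredientRep {K : Subgroup G} (hK : IsCompact (K : Set G)) (lam : ρ.Contragredient) :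
    Contragredient.subtype ρ (avg ρ.contragredientRep K lam) = avg ρ.dual K (Contragredient.subtype ρ lam) :=
  map_avg hK (Literature.RepresentationTheory.FiniteGroups.Subrepresentation.subtypeIntertwiningMap ρ.contragredient)
    (ρ.isSmooth_contragredientRep lam)

/-- **Reflexivity of admissible representations** (Bernstein–Zelevinsky 1976, Prop. 2.15;
Bushnell–Henniart 2006, §2.9): if `ρ` is admissible and `G` has a compact open subgroup `K₀`, every
smooth linear form `Φ` on the contragredient `Ṽ` is evaluation at a vector: `Φ λ = λ v` for some
`v ∈ V`. Proof: `Φ` is fixed by a compact open `K`; `Φ (μ₀ ∘ e_K)`, `μ₀ ∈ (V^K)^*`, is a functional on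
the finite-dimensional `(V^K)^*`, hence evaluation at some `v ∈ V^K`; and
`Φ λ = Φ (e_K λ) = Φ ((λ ∘ e_K)|) = λ (e_K v) = λ v`. [cite: BernsteinZelevinsky1976, Proposition 2.15] -/
theorem exists_eval_eq_of_mem_contragredient_contragredient (hρ : ρ.IsAdmissible) {K₀ : Subgroup G}
    (hK₀o : IsOpen (K₀ : Set G)) (hK₀c : IsCompact (K₀ : Set G))
    {Φ : Module.Dual k ρ.Contragredient} (hΦ : Φ ∈ ρ.contragredientRep.contragredient) :
    ∃ v : V, ∀ lam : ρ.Contragredient, Φ lam = Contragredient.subtype ρ lam v := by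
  -- a compact open `K` fixing `Φ`
  set K : Subgroup G := K₀ ⊓ ρ.contragredientRep.dual.stabilizerSubgroup Φ with hKdef
  have hKo : IsOpen (K : Set G) := hK₀o.inter hΦ
  have hKc : IsCompact (K : Set G) := hK₀c.of_isClosed_subset (Subgroup.isClosed_of_isOpen _ hKo) fun g hg => hg.1
  have hΦK : ∀ g ∈ K, ρ.contragredientRep.dual g Φ = Φ := fun g hg => hg.2
  haveI : Module.Finite k (ρ.fixedPoints K) := hρ.2 ⟨K, hKo⟩ hKc
  have hsm := hρ.isSmooth
  -- `μ₀ ↦ μ₀ ∘ e_K`, a linear map `(V^K)^* → Ṽ`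
  let ext : Module.Dual k (ρ.fixedPoints K) →ₗ[k] ρ.Contragredient :=
    { toFun := fun μ₀ => ⟨μ₀ ∘ₗ (LinearMap.codRestrict (ρ.fixedPoints K) (avgLinear K hsm hKc)
          fun x => avg_mem_fixedPoints hKc (hsm x)),
        ρ.dual.isSmoothVector_of_le hKo fun g hg => by
          rw [mem_stabilizerSubgroup]
          ext x
          simp only [dual_apply, Module.Dual.transpose_apply, LinearMap.comp_apply]
          congr 1
          apply Subtype.ext
          simp only [LinearMap.codRestrict_apply, avgLinear_apply]
          exact avg_apply_of_mem (K.inv_mem hg)⟩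
      map_add' := fun _ _ => Subtype.ext (by ext; rfl)
      map_smul' := fun _ _ => Subtype.ext (by ext; rfl) }
  have hext : ∀ (μ₀ : Module.Dual k (ρ.fixedPoints K)) (x : V),
      Contragredient.subtype ρ (ext μ₀) x = μ₀ ⟨avg ρ K x, avg_mem_fixedPoints hKc (hsm x)⟩ := fun _ _ => rfl
  obtain ⟨v, hv⟩ : ∃ v : ρ.fixedPoints K, ∀ μ₀ : Module.Dual k (ρ.fixedPoints K), Φ (ext μ₀) = μ₀ v :=
    ⟨(Module.evalEquiv k (ρ.fixedPoints K)).symm (Φ ∘ₗ ext), fun μ₀ =>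
      (Module.apply_evalEquiv_symm_apply k (ρ.fixedPoints K) μ₀ (Φ ∘ₗ ext)).symm⟩
  refine ⟨v, fun lam => ?_⟩
  -- `Φ lam = Φ (e_K lam)` and `e_K lam = ext (lam|_{V^K})`
  have hsmc := ρ.isSmooth_contragredientRep
  have h1 : Φ lam = Φ (avg ρ.contragredientRep K lam) := (dual_apply_avg hKc (hsmc lam) hΦK).symm
  have h2 : avg ρ.contragredientRep K lam = ext ((Contragredient.subtype ρ lam) ∘ₗ (ρ.fixedPoints K).subtype) := by
    apply Contragredient.subtype_injective ρ
    rw [subtype_avg_contragredientRep hKc]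
    ext x
    rw [hext, LinearMap.comp_apply, Submodule.subtype_apply]
    exact avg_dual_apply_eq_apply_avg hKc lam.2 (hsm x)
  rw [h1, h2, hv, LinearMap.comp_apply, Submodule.subtype_apply]

/-- **The contragredient of an admissible supercuspidal representation is supercuspidal**: by
reflexivity its smooth matrix coefficients are `g ↦ λ (ρ(g⁻¹) v) = c_{λ,v}(g⁻¹)`, supported in
`(C Z)⁻¹ = C⁻¹ Z`. (Bernstein–Zelevinsky 1976, §3.21 with Prop. 2.15; Bushnell–Henniart 2006,
§10.1.) [folklore] -/
theorem IsSupercuspidal.contragredientRep (hsc : ρ.IsSupercuspidal) (hρ : ρ.IsAdmissible) {K₀ : Subgroup G}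
    (hK₀o : IsOpen (K₀ : Set G)) (hK₀c : IsCompact (K₀ : Set G)) : ρ.contragredientRep.IsSupercuspidal := by
  intro Φ hΦ lam
  obtain ⟨v, hv⟩ := exists_eval_eq_of_mem_contragredient_contragredient hρ hK₀o hK₀c hΦ
  obtain ⟨C, hC, hsupp⟩ := hsc (Contragredient.subtype ρ lam) lam.2 v
  refine ⟨C⁻¹, hC.inv, fun g hg => ?_⟩
  rw [Function.mem_support, matrixCoeff_apply, hv, subtype_contragredientRep_apply, dual_apply,
    Module.Dual.transpose_apply, LinearMap.comp_apply] at hg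
  have hg' : g⁻¹ ∈ C * (Subgroup.center G : Set G) := hsupp (by rwa [Function.mem_support, matrixCoeff_apply])
  obtain ⟨c, hc, z, hz, hcz⟩ := Set.mem_mul.1 hg'
  refine Set.mem_mul.2 ⟨c⁻¹, Set.inv_mem_inv.2 hc, z⁻¹, (Subgroup.center G).inv_mem hz, ?_⟩
  have : g = (c * z)⁻¹ := by rw [hcz, inv_inv]
  rw [this, mul_inv_rev, ((Subgroup.mem_center_iff.1 ((Subgroup.center G).inv_mem hz)) c⁻¹)]

end Reflexive

/-! ### Restriction to open subgroups -/

section OpenSubgroup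

variable {k L V : Type*} [CommRing k] [Group L] [TopologicalSpace L] [IsTopologicalGroup L]
  [AddCommGroup V] [Module k V] {ρ : Representation k L V}

/-- A form smooth for the restriction to an open subgroup is smooth. [folklore] -/
theorem mem_contragredient_of_compSubtype {H : Subgroup L} (hH : IsOpen (H : Set L)) {φ : Module.Dual k V}
    (hφ : φ ∈ Representation.contragredient (G := H) (ρ.comp H.subtype)) : φ ∈ ρ.contragredient := by
  rw [mem_contragredient] at hφ ⊢
  change IsOpen (((Representation.dual (G := H) (ρ.comp H.subtype)).stabilizerSubgroup φ : Subgroup H) : Set H) at hφ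
  change IsOpen ((ρ.dual.stabilizerSubgroup φ : Subgroup L) : Set L)
  have hle : ((Representation.dual (G := H) (ρ.comp H.subtype)).stabilizerSubgroup φ).map H.subtype ≤
      ρ.dual.stabilizerSubgroup φ := by
    rintro _ ⟨h, hh, rfl⟩
    exact hh
  refine Subgroup.isOpen_mono hle ?_
  exact hH.isOpenEmbedding_subtypeVal.isOpenMap _ hφ

/-- **Restriction to an open subgroup preserves supercuspidality**: if the smooth coefficients of
`ρ` are supported in `C · Z(L)` (`C` compact), those of `ρ|_H` (`H` open) are supported in
`C' · Z(H)` with `C' = ⋃_t (C z_t ∩ H)` compact, `t` running over finitely many cosets `tH ⊇ C⁻¹`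
and `z_t ∈ Z(L) ∩ tH`. (Bernstein–Zelevinsky 1976, §3.21; Bushnell–Henniart 2006, §10.1.) [folklore] -/
theorem IsSupercuspidal.compSubtype (hρ : ρ.IsSupercuspidal) (H : Subgroup L) (hH : IsOpen (H : Set L)) :
    IsSupercuspidal (G := H) (ρ.comp H.subtype) := by
  classical
  intro φ hφ v
  obtain ⟨C, hC, hsupp⟩ := hρ φ (mem_contragredient_of_compSubtype hH hφ) v
  -- finitely many cosets `t • H` cover `C⁻¹`
  have hCi : IsCompact C⁻¹ := hC.inv
  obtain ⟨T, hT⟩ := hCi.elim_finite_subcover (fun t : L => t • (H : Set L))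
    (fun t => hH.smul t) fun x _ => Set.mem_iUnion.2 ⟨x, by simpa using Set.smul_mem_smul_set (a := x) H.one_mem⟩
  -- central representatives of the cosets meeting the centre
  have hz : ∀ t : L, ∃ z : L, (∃ z' ∈ (Subgroup.center L : Set L), z' ∈ t • (H : Set L)) →
      z ∈ (Subgroup.center L : Set L) ∧ z ∈ t • (H : Set L) := fun t => by
    by_cases h : ∃ z' ∈ (Subgroup.center L : Set L), z' ∈ t • (H : Set L)
    · obtain ⟨z', hz', hz't⟩ := h
      exact ⟨z', fun _ => ⟨hz', hz't⟩⟩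
    · exact ⟨1, fun h' => absurd h' h⟩
  choose z hz using hz
  -- the compact set `C'`
  have hHc : IsClosed (H : Set L) := Subgroup.isClosed_of_isOpen H hH
  let C' : Set H := ⋃ t ∈ T, Subtype.val ⁻¹' (C * {z t})
  have hC' : IsCompact C' := by
    refine T.finite_toSet.isCompact_biUnion fun t _ => ?_
    rw [Topology.IsEmbedding.subtypeVal.isCompact_iff, Set.image_preimage_eq_inter_range, Subtype.range_coe]
    exact (hC.mul isCompact_singleton).inter_right hHc
  refine ⟨C', hC', fun x hx => ?_⟩
  have hxL : (x : L) ∈ C * (Subgroup.center L : Set L) :=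
    hsupp (by rw [Function.mem_support, matrixCoeff_apply] at hx ⊢; exact hx)
  obtain ⟨c, hc, w, hw, hcw⟩ := Set.mem_mul.1 hxL
  -- `c⁻¹ ∈ t • H` for some `t ∈ T`, and then `w = c⁻¹ x ∈ t • H`
  obtain ⟨t, htT, hct⟩ := Set.mem_iUnion₂.1 (hT (Set.inv_mem_inv.2 hc))
  have hwt : w ∈ t • (H : Set L) := by
    obtain ⟨h₀, hh₀, hch⟩ := Set.mem_smul_set.1 hct
    refine Set.mem_smul_set.2 ⟨h₀ * x, H.mul_mem hh₀ x.2, ?_⟩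
    rw [smul_eq_mul, ← mul_assoc, show t * h₀ = c⁻¹ from hch, ← hcw, inv_mul_cancel_left]
  obtain ⟨hzc, hzt⟩ := hz t ⟨w, hw, hwt⟩
  -- `z_t⁻¹ w ∈ H ∩ Z(L)` and `c z_t ∈ H`
  have hzw : (z t)⁻¹ * w ∈ H := by
    obtain ⟨h₁, hh₁, h1⟩ := Set.mem_smul_set.1 hzt
    obtain ⟨h₂, hh₂, h2⟩ := Set.mem_smul_set.1 hwt
    rw [← h1, ← h2, smul_eq_mul, smul_eq_mul, mul_inv_rev, mul_assoc, inv_mul_cancel_left]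
    exact H.mul_mem (H.inv_mem hh₁) hh₂
  have hzwc : (z t)⁻¹ * w ∈ Subgroup.center L := (Subgroup.center L).mul_mem ((Subgroup.center L).inv_mem hzc) hw
  have hczH : c * z t ∈ H := by
    have : c * z t = (x : L) * ((z t)⁻¹ * w)⁻¹ := by
      rw [mul_inv_rev, inv_inv, ← hcw, mul_assoc, mul_inv_cancel_left]
    rw [this]
    exact H.mul_mem x.2 (H.inv_mem hzw)
  refine Set.mem_mul.2 ⟨⟨c * z t, hczH⟩, Set.mem_iUnion₂.2 ⟨t, htT, Set.mul_mem_mul hc rfl⟩,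
    ⟨(z t)⁻¹ * w, hzw⟩, SetLike.mem_coe.2 (Subgroup.mem_center_iff.2 fun h =>
      Subtype.ext ((Subgroup.mem_center_iff.1 hzwc) (h : L))), Subtype.ext ?_⟩
  change c * z t * ((z t)⁻¹ * w) = x
  rw [mul_assoc, mul_inv_cancel_left, hcw]

end OpenSubgroup

end Representation
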